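import Summits.CriticalPhenomena.PercolationContinuityZ3.Theorems.PercNearOneGluingNoHeavyLowerTailSunflowerMultiPetalModuleLift
import Summits.CriticalPhenomena.PercolationContinuityZ3.Theorems.PercNearOneGluingNoHeavyLowerTailSunflowerMultiPetalDual
import Summits.CriticalPhenomena.PercolationContinuityZ3.Theorems.PercNearOneGluingNoHeavyLowerTailSunflowerMultiPetalCompleting
import HarnessLib
import HarnessLib.Audit

/-!
# `NoHeavyLowerTail` (crux stmt-CriticalPhenomena-4575), abstract sunflower cubic, `k` petals: CONJECTURE G FOR `D = {e}` AT EVERY COORDINATE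
# WHOSE SINGLETON IS A PETAL OR KERNEL SET (more generally at every upper-one-petal coordinate)

Support file (seat `prim-l12-p2` gen 33; `--supports stmt-CriticalPhenomena-4575`; companion of `…SunflowerMultiPetalModuleLift` (this gen:
`gsum_twoLift_nonneg`, `gsum_swap12/23`, `lab_union_cases_of_lab_ne_zero`), `…SunflowerMultiPetalHomeRouting` (p359567: `MSunflower.ZKflip`,
`FlipPartitionLemmaK` = Conjecture G) and `…SunflowerTracePartition` (trace decomposition of `parts α`)).  Everything here is PROVED; no `sorry`.
Memo: run/shared/lean/prim/prim-l12/prim-l12-p2/FINDING-g33-MODULE-LIFT.md.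

* `ZKflip_singleton_eq` : `ZKflip {e} = gsum {e}ᶜ {e} {e} ∅ + gsum {e}ᶜ {e} ∅ {e} + gsum {e}ᶜ ∅ {e} {e}` — the single-flip functional (the element `e`
  sits in exactly two of the three blocks) as three two-lift glued sums (trace decomposition along `{e}`, `partsOf_singleton`).
* **`ZKflip_singleton_nonneg_of_upper`**, **`ZKflip_singleton_nonneg_of_lab_ne_zero`**: `0 ≤ ZKflip {e}` whenever the upper section at `e` uses at most
  one petal colour, in particular whenever `lab {e} ≠ 0` — the `|D| = 1` case of Conjecture G (`FlipPartitionLemmaK`) at such coordinates, every `k`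
  (the `|D| = 0` companion (MZₖ)/★ₖ at such coordinates is p341252/p343107).  Equivalently: OR-doubling a coordinate whose singleton is a petal or kernel
  set never decreases the partition functional.
* `gsum_twoLift_singleton_nonneg` : the window form `0 ≤ gsum W {e} {e} ∅`;  by G-duality (p368605 `ZKflip_dual`) `ZKflip_compl_singleton_nonneg_of_lab_ne_last`:
  `0 ≤ ZKflip {e}ᶜ` whenever the co-singleton `{e}ᶜ` is not a kernel set (the `|D| = n − 1` coefficients of G at such `e`).
* PETAL-COMPLETING coordinates / modules (class (4) of the one-point atlas; `…SunflowerMultiPetalCompleting`, p-gen 26): the pointwise FLIP inequality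
  `pcFlipIneqK` : `kkK y₁ z₁ + kkK x₁ z₁ + kkK x₁ y₁ ≤ s6K x₁ y₁ z₀ + s6K x₁ y₀ z₁ + s6K x₀ y₁ z₁` under `x₀ = 0 ∨ x₁ = ⊤` (etc.; `decide` on `Fin 5` + the
  three-petal chart of p-gen 26), whose left side sums to doubly-offset antipodal-Gladkov sums `pol · M M ≥ 0`; hence `gsum_twoLift_nonneg_of_completing`
  (`0 ≤ gsum W M M ∅` when `lab X = 0 ∨ lab (X ∪ M) = ⊤` on `W`), `gsum_oneLift_nonneg_of_completing`, the COMPLETING-MODULE REDUCTION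
  `gsum_nonneg_of_isModule_of_completing` (★ₖ on the window reduces to ★ₖ of the deletion AND of the contraction along the module), and
  **`ZKflip_singleton_nonneg_of_petalCompleting`: `0 ≤ ZKflip {e}` at every petal-completing coordinate `e`** (Conjecture G, `|D| = 1`, class (4)).
  The certificate LPs (kit j205032): classes (2), (4), (8) admit absolute pointwise T₂-certificates; the inert classes (7)/(10) do not (they need the
  functional of the smaller cube, as for (MZₖ)).
-/

namespace Summit.CriticalPhenomena.PercolationContinuityZ3.Theorems.SunflowerPartition

open Finset

variable {α : Type*} [DecidableEq α]

namespace MSunflower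

variable {k : ℕ} (F : MSunflower k α)

/-- **The single-flip functional at a coordinate with a non-bottom singleton**: `0 ≤ gsum W {e} {e} ∅` for every window `W` whenever `lab {e} ≠ 0`
(the `|D| = 1` companion of p343107's (MZₖ) at such coordinates). [this work] -/
theorem gsum_twoLift_singleton_nonneg (W : Finset α) (e : α) (he : F.lab {e} ≠ 0) : 0 ≤ F.gsum W {e} {e} ∅ :=
  F.gsum_twoLift_nonneg W {e} (F.lab {e}) fun X _ => F.lab_union_cases_of_lab_ne_zero {e} X he

/-! ## The single-flip coefficient of Conjecture G at an upper-one-petal coordinate -/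

omit [DecidableEq α] in
/-- For `e ∉ A`: `A ∆ {e} = A ∪ {e}`. [folklore] -/
theorem symmDiff_singleton_of_not_mem [DecidableEq α] {A : Finset α} {e : α} (h : e ∉ A) : symmDiff A {e} = A ∪ {e} := by
  ext x
  rw [mem_symmDiff, mem_union, mem_singleton]
  constructor
  · rintro (⟨hx, -⟩ | ⟨hx, -⟩)
    · exact Or.inl hx
    · exact Or.inr hx
  · rintro (hx | hx)
    · exact Or.inl ⟨hx, fun hxe => h (hxe ▸ hx)⟩
    · exact Or.inr ⟨hx, fun hxA => h (hx ▸ hxA)⟩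

omit [DecidableEq α] in
/-- For `e ∉ A`: `(A ∪ {e}) ∆ {e} = A`. [folklore] -/
theorem symmDiff_union_singleton_of_not_mem [DecidableEq α] {A : Finset α} {e : α} (h : e ∉ A) : symmDiff (A ∪ {e}) {e} = A := by
  ext x
  rw [mem_symmDiff, mem_union, mem_singleton]
  constructor
  · rintro (⟨hx | hx, hne⟩ | ⟨hx, hn⟩)
    · exact hx
    · exact absurd hx hne
    · exact absurd (Or.inr hx) hn
  · intro hx
    exact Or.inl ⟨Or.inl hx, fun hxe => h (hxe ▸ hx)⟩

omit [DecidableEq α] in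
/-- The three ordered 3-partitions of a singleton. [this work] -/
theorem partsOf_singleton [DecidableEq α] (e : α) :
    partsOf ({e} : Finset α) = {((∅ : Finset α), (∅ : Finset α)), (∅, {e}), ({e}, ∅)} := by
  ext s
  rw [Sunflower.mem_partsOf_iff, subset_singleton_iff, subset_singleton_iff, mem_insert, mem_insert, mem_singleton]
  constructor
  · rintro ⟨h1 | h1, h2 | h2, hd⟩
    · exact Or.inl (Prod.ext h1 h2)
    · exact Or.inr (Or.inl (Prod.ext h1 h2))
    · exact Or.inr (Or.inr (Prod.ext h1 h2))
    · exfalso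
      rw [h1, h2, disjoint_self, bot_eq_empty] at hd
      exact singleton_ne_empty e hd
  · rintro (h | h | h)
    · rw [h]; exact ⟨Or.inl rfl, Or.inl rfl, disjoint_empty_left _⟩
    · rw [h]; exact ⟨Or.inl rfl, Or.inr rfl, disjoint_empty_left _⟩
    · rw [h]; exact ⟨Or.inr rfl, Or.inl rfl, disjoint_empty_right _⟩

/-- **The single-flip functional as three two-lift glued sums**: `ZKflip {e} = gsum {e}ᶜ ∅ {e} {e} + gsum {e}ᶜ {e} ∅ {e} + gsum {e}ᶜ {e} {e} ∅`
(the element `e` lies in exactly two of the three blocks). [this work] -/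
theorem ZKflip_singleton_eq [Fintype α] (e : α) :
    F.ZKflip {e} = F.gsum {e}ᶜ {e} {e} ∅ + F.gsum {e}ᶜ {e} ∅ {e} + F.gsum {e}ᶜ ∅ {e} {e} := by
  unfold ZKflip
  rw [sum_parts_eq_sum_traces {e}, partsOf_singleton]
  have n1 : ((∅ : Finset α), (∅ : Finset α)) ∉ ({((∅ : Finset α), ({e} : Finset α)), ({e}, ∅)} : Finset (Finset α × Finset α)) := by
    rw [mem_insert, mem_singleton, not_or]
    exact ⟨fun h => singleton_ne_empty e (congrArg Prod.snd h).symm, fun h => singleton_ne_empty e (congrArg Prod.fst h).symm⟩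
  have n2 : ((∅ : Finset α), ({e} : Finset α)) ∉ ({(({e} : Finset α), (∅ : Finset α))} : Finset (Finset α × Finset α)) := by
    rw [mem_singleton]
    exact fun h => singleton_ne_empty e (congrArg Prod.snd h)
  rw [sum_insert n1, sum_insert n2, sum_singleton]
  have hmem : ∀ s ∈ partsOf ({e} : Finset α), ∑ q ∈ (parts α).filter (fun q => q.1 ∩ {e} = s.1 ∧ q.2 ∩ {e} = s.2),
      s6K k (F.lab (symmDiff q.1 {e})) (F.lab (symmDiff q.2 {e})) (F.lab (symmDiff (q.1 ∪ q.2)ᶜ {e}))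
      = ∑ r ∈ partsOf {e}ᶜ, s6K k (F.lab (symmDiff (r.1 ∪ s.1) {e})) (F.lab (symmDiff (r.2 ∪ s.2) {e}))
          (F.lab (symmDiff (({e}ᶜ \ (r.1 ∪ r.2)) ∪ ({e} \ (s.1 ∪ s.2))) {e})) := fun s hs =>
    sum_parts_trace_eq {e} hs (fun X Y Z => s6K k (F.lab (symmDiff X {e})) (F.lab (symmDiff Y {e})) (F.lab (symmDiff Z {e})))
  have hs0 : ((∅ : Finset α), (∅ : Finset α)) ∈ partsOf ({e} : Finset α) := by rw [partsOf_singleton]; simp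
  have hs1 : ((∅ : Finset α), ({e} : Finset α)) ∈ partsOf ({e} : Finset α) := by rw [partsOf_singleton]; simp
  have hs2 : (({e} : Finset α), (∅ : Finset α)) ∈ partsOf ({e} : Finset α) := by rw [partsOf_singleton]; simp
  rw [hmem _ hs0, hmem _ hs1, hmem _ hs2]
  have hne : ∀ r ∈ partsOf ({e}ᶜ : Finset α), e ∉ r.1 ∧ e ∉ r.2 ∧ e ∉ ({e}ᶜ : Finset α) \ (r.1 ∪ r.2) := by
    intro r hr
    obtain ⟨h1, h2, -⟩ := (Sunflower.mem_partsOf_iff).1 hr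
    have he : e ∉ ({e}ᶜ : Finset α) := fun h => (mem_compl.1 h) (mem_singleton_self e)
    exact ⟨fun h => he (h1 h), fun h => he (h2 h), fun h => he (mem_sdiff.1 h).1⟩
  unfold gsum
  simp only [empty_union, union_empty, sdiff_self, bot_eq_empty, sdiff_empty]
  rw [add_assoc]
  refine congrArg₂ (· + ·) ?_ (congrArg₂ (· + ·) ?_ ?_)
  · refine sum_congr rfl fun r hr => ?_
    obtain ⟨h1, h2, h3⟩ := hne r hr
    rw [symmDiff_singleton_of_not_mem h1, symmDiff_singleton_of_not_mem h2, symmDiff_union_singleton_of_not_mem h3]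
  · refine sum_congr rfl fun r hr => ?_
    obtain ⟨h1, h2, h3⟩ := hne r hr
    rw [symmDiff_singleton_of_not_mem h1, symmDiff_union_singleton_of_not_mem h2, symmDiff_singleton_of_not_mem h3]
  · refine sum_congr rfl fun r hr => ?_
    obtain ⟨h1, h2, h3⟩ := hne r hr
    rw [symmDiff_union_singleton_of_not_mem h1, symmDiff_singleton_of_not_mem h2, symmDiff_singleton_of_not_mem h3]

/-- **CONJECTURE G FOR `D = {e}` AT EVERY UPPER-ONE-PETAL COORDINATE**: if all upper labels `lab (X ∪ {e})` lie in `{0, p, ⊤}` for one label `p`,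
then `0 ≤ ZKflip {e}`. [this work] -/
theorem ZKflip_singleton_nonneg_of_upper [Fintype α] (e : α) (p : Fin (k + 2))
    (hup : ∀ X ⊆ ({e}ᶜ : Finset α), F.lab (X ∪ {e}) = 0 ∨ F.lab (X ∪ {e}) = p ∨ F.lab (X ∪ {e}) = Fin.last (k + 1)) :
    0 ≤ F.ZKflip {e} := by
  rw [F.ZKflip_singleton_eq e]
  have h := F.gsum_twoLift_nonneg {e}ᶜ {e} p hup
  have h1 : 0 ≤ F.gsum {e}ᶜ {e} ∅ {e} := by rw [F.gsum_swap23]; exact h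
  have h2 : 0 ≤ F.gsum {e}ᶜ ∅ {e} {e} := by rw [F.gsum_swap12, F.gsum_swap23]; exact h
  linarith

/-- **CONJECTURE G FOR `D = {e}` WHENEVER THE SINGLETON `{e}` IS A PETAL OR KERNEL SET**: `lab {e} ≠ 0 → 0 ≤ ZKflip {e}` — the `|D| = 1`
companion of `ZK_nonneg_of_forall_lab_singleton_ne_zero` (p343107), for every number `k` of petals. [this work] -/
theorem ZKflip_singleton_nonneg_of_lab_ne_zero [Fintype α] (e : α) (he : F.lab {e} ≠ 0) : 0 ≤ F.ZKflip {e} :=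
  F.ZKflip_singleton_nonneg_of_upper e (F.lab {e}) fun X _ => F.lab_union_cases_of_lab_ne_zero {e} X he


/-- **By G-duality**: `0 ≤ ZKflip {e}ᶜ` whenever `lab {e}ᶜ ≠ ⊤` (the singleton `{e}` of the DUAL structure is then a petal or kernel set; p368605
`ZKflip_dual`). [this work] -/
theorem ZKflip_compl_singleton_nonneg_of_lab_ne_last [Fintype α] (e : α) (he : F.lab {e}ᶜ ≠ Fin.last (k + 1)) :
    0 ≤ F.ZKflip {e}ᶜ := by
  rw [← F.ZKflip_dual {e}]
  refine F.dual.ZKflip_singleton_nonneg_of_lab_ne_zero e ?_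
  rw [F.lab_dual]
  exact fun h => he ((swapTB_eq_zero_iff k _).1 h)

/-! ## Petal-completing coordinates and modules: the flip inequality with doubly-offset Gladkov sums -/

end MSunflower

/-- The two-lift kernel inequality on `Fin 5` codes for petal-completing chains (`decide`). [this work] -/
theorem pcFlipIneq5 : ∀ x0 x1 y0 y1 z0 z1 : Fin 5, (x0 = 0 ∨ x1 = 4) → (y0 = 0 ∨ y1 = 4) → (z0 = 0 ∨ z1 = 4) →
    kkK 3 y1 z1 + kkK 3 x1 z1 + kkK 3 x1 y1 ≤ s6K 3 x1 y1 z0 + s6K 3 x1 y0 z1 + s6K 3 x0 y1 z1 := by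
  decide

/-- **The two-lift (flip) kernel inequality at petal-completing chains, every `k`**: if `x₀ = 0 ∨ x₁ = ⊤`, `y₀ = 0 ∨ y₁ = ⊤`, `z₀ = 0 ∨ z₁ = ⊤`, then
`kkK y₁ z₁ + kkK x₁ z₁ + kkK x₁ y₁ ≤ s6K x₁ y₁ z₀ + s6K x₁ y₀ z₁ + s6K x₀ y₁ z₁` (chart the at most three petal values into `Fin 5`, as in `pcIneqK`). [this work] -/
theorem pcFlipIneqK {k : ℕ} (x0 x1 y0 y1 z0 z1 : Fin (k + 2)) (hx : x0 = 0 ∨ x1 = Fin.last (k + 1)) (hy : y0 = 0 ∨ y1 = Fin.last (k + 1))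
    (hz : z0 = 0 ∨ z1 = Fin.last (k + 1)) :
    kkK k y1 z1 + kkK k x1 z1 + kkK k x1 y1 ≤ s6K k x1 y1 z0 + s6K k x1 y0 z1 + s6K k x0 y1 z1 := by
  set P1 : Fin (k + 2) := if x0 = 0 then x1 else x0 with hP1
  set P2 : Fin (k + 2) := if y0 = 0 then y1 else y0 with hP2
  set c := chart3 k P1 P2 with hc
  have e4 : (4 : Fin 5) = Fin.last (3 + 1) := rfl
  have T := fun w => e4 ▸ (chart3_eq_four_iff k P1 P2 w).symm
  have Zr := fun w => (chart3_eq_zero_iff k P1 P2 w).symm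
  have nx0 : x0 ≠ Fin.last (k + 1) → x0 ≠ 0 → x0 ≠ P1 → False := by
    intro _ h0 hp; apply hp; rw [hP1, if_neg h0]
  have nx1 : x1 ≠ Fin.last (k + 1) → x1 ≠ 0 → x1 ≠ P1 → False := by
    intro ht _ hp; apply hp; rcases hx with h0 | h1
    · rw [hP1, if_pos h0]
    · exact absurd h1 ht
  have ny0 : y0 ≠ Fin.last (k + 1) → y0 ≠ 0 → y0 ≠ P2 → False := by
    intro _ h0 hp; apply hp; rw [hP2, if_neg h0]
  have ny1 : y1 ≠ Fin.last (k + 1) → y1 ≠ 0 → y1 ≠ P2 → False := by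
    intro ht _ hp; apply hp; rcases hy with h0 | h1
    · rw [hP2, if_pos h0]
    · exact absurd h1 ht
  have Exy : ∀ {w w' : Fin (k + 2)}, (w ≠ Fin.last (k + 1) → w ≠ 0 → w ≠ P1 → w ≠ P2 → False) → (w = w' ↔ c w = c w') :=
    fun hw => chart3_eq_iff_petal k P1 P2 (fun a b d g _ _ _ _ => (hw a b d g).elim)
  have hX0 : x0 ≠ Fin.last (k + 1) → x0 ≠ 0 → x0 ≠ P1 → x0 ≠ P2 → False := fun a b d _ => nx0 a b d
  have hX1 : x1 ≠ Fin.last (k + 1) → x1 ≠ 0 → x1 ≠ P1 → x1 ≠ P2 → False := fun a b d _ => nx1 a b d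
  have hY0 : y0 ≠ Fin.last (k + 1) → y0 ≠ 0 → y0 ≠ P1 → y0 ≠ P2 → False := fun a b _ g => ny0 a b g
  have hY1 : y1 ≠ Fin.last (k + 1) → y1 ≠ 0 → y1 ≠ P1 → y1 ≠ P2 → False := fun a b _ g => ny1 a b g
  rw [kkK_congr (T y1) (Zr y1) (T z1) (Zr z1) (Exy hY1), kkK_congr (T x1) (Zr x1) (T z1) (Zr z1) (Exy hX1),
    kkK_congr (T x1) (Zr x1) (T y1) (Zr y1) (Exy hX1),
    s6K_congr (T x1) (Zr x1) (T y1) (Zr y1) (T z0) (Zr z0) (Exy hX1) (Exy hY1) (Exy hX1),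
    s6K_congr (T x1) (Zr x1) (T y0) (Zr y0) (T z1) (Zr z1) (Exy hX1) (Exy hY0) (Exy hX1),
    s6K_congr (T x0) (Zr x0) (T y1) (Zr y1) (T z1) (Zr z1) (Exy hX0) (Exy hY1) (Exy hX0)]
  refine pcFlipIneq5 _ _ _ _ _ _ ?_ ?_ ?_
  · rcases hx with h | h
    · exact Or.inl ((Zr x0).1 h)
    · exact Or.inr (e4 ▸ (T x1).1 h)
  · rcases hy with h | h
    · exact Or.inl ((Zr y0).1 h)
    · exact Or.inr (e4 ▸ (T y1).1 h)
  · rcases hz with h | h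
    · exact Or.inl ((Zr z0).1 h)
    · exact Or.inr (e4 ▸ (T z1).1 h)

namespace MSunflower

variable {k : ℕ} (F : MSunflower k α)

/-- The doubly-glued Gladkov sum behind a free first block: `0 ≤ Σ_{(X,Y,Z) ⊢ W} kkK (lab (Y ∪ M)) (lab (Z ∪ M))` (offset antipodal Gladkov with equal
offsets `M` on `W ∖ X`, p339016 `antipodal_sum_nonneg`). [this work] -/
theorem sum_partsOf_kkK_glue_nonneg (W M : Finset α) :
    0 ≤ ∑ r ∈ partsOf W, kkK k (F.lab (r.2 ∪ M)) (F.lab ((W \ (r.1 ∪ r.2)) ∪ M)) := by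
  rw [sum_partsOf_eq_sum_powerset W (fun X Y => kkK k (F.lab (Y ∪ M)) (F.lab ((W \ (X ∪ Y)) ∪ M)))]
  refine sum_nonneg fun X _ => ?_
  have h := F.antipodal_sum_nonneg (W \ X) M M (subset_refl M)
  refine le_of_le_of_eq h (sum_congr rfl fun Y _ => ?_)
  rw [union_comm M Y, union_comm M ((W \ X) \ Y), sdiff_sdiff_left, sup_eq_union]

/-- The plain Gladkov sum behind a free first block: `0 ≤ Σ_{(X,Y,Z) ⊢ W} kkK (lab Y) (lab Z)`. [this work] -/
theorem sum_partsOf_kkK_nonneg' (W : Finset α) :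
    0 ≤ ∑ r ∈ partsOf W, kkK k (F.lab r.2) (F.lab (W \ (r.1 ∪ r.2))) := by
  have h := F.sum_partsOf_kkK_glue_nonneg W ∅
  simpa only [union_empty] using h

/-- **The flip inequality at a PETAL-COMPLETING module**, summed form: if `lab X = 0 ∨ lab (X ∪ M) = ⊤` for all `X ⊆ W`, the three two-lift glued sums
dominate three doubly-glued Gladkov sums. [this work] -/
theorem gsum_twoLift_sum_nonneg_of_completing (W M : Finset α) (hpc : ∀ X ⊆ W, F.lab X = 0 ∨ F.lab (X ∪ M) = Fin.last (k + 1)) :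
    0 ≤ F.gsum W M M ∅ + F.gsum W M ∅ M + F.gsum W ∅ M M := by
  have g1 := F.sum_partsOf_kkK_glue_nonneg W M
  have g2 : 0 ≤ ∑ r ∈ partsOf W, kkK k (F.lab (r.1 ∪ M)) (F.lab ((W \ (r.1 ∪ r.2)) ∪ M)) := by
    have h : ∑ r ∈ partsOf W, kkK k (F.lab (r.1 ∪ M)) (F.lab ((W \ (r.1 ∪ r.2)) ∪ M))
        = ∑ r ∈ partsOf W, kkK k (F.lab (r.2 ∪ M)) (F.lab ((W \ (r.1 ∪ r.2)) ∪ M)) :=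
      sum_partsOf_swap12 W (fun a _ d => kkK k (F.lab (a ∪ M)) (F.lab (d ∪ M)))
    rw [h]; exact g1
  have g3 : 0 ≤ ∑ r ∈ partsOf W, kkK k (F.lab (r.1 ∪ M)) (F.lab (r.2 ∪ M)) := by
    have h : ∑ r ∈ partsOf W, kkK k (F.lab (r.1 ∪ M)) (F.lab (r.2 ∪ M))
        = ∑ r ∈ partsOf W, kkK k (F.lab (r.1 ∪ M)) (F.lab ((W \ (r.1 ∪ r.2)) ∪ M)) :=
      sum_partsOf_swap23 W (fun a b _ => kkK k (F.lab (a ∪ M)) (F.lab (b ∪ M)))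
    rw [h]; exact g2
  unfold gsum
  simp only [union_empty]
  rw [← sum_add_distrib, ← sum_add_distrib]
  have key : ∑ r ∈ partsOf W, kkK k (F.lab (r.2 ∪ M)) (F.lab ((W \ (r.1 ∪ r.2)) ∪ M))
      + ∑ r ∈ partsOf W, kkK k (F.lab (r.1 ∪ M)) (F.lab ((W \ (r.1 ∪ r.2)) ∪ M))
      + ∑ r ∈ partsOf W, kkK k (F.lab (r.1 ∪ M)) (F.lab (r.2 ∪ M))
      ≤ ∑ r ∈ partsOf W, (s6K k (F.lab (r.1 ∪ M)) (F.lab (r.2 ∪ M)) (F.lab (W \ (r.1 ∪ r.2)))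
          + s6K k (F.lab (r.1 ∪ M)) (F.lab r.2) (F.lab ((W \ (r.1 ∪ r.2)) ∪ M))
          + s6K k (F.lab r.1) (F.lab (r.2 ∪ M)) (F.lab ((W \ (r.1 ∪ r.2)) ∪ M))) := by
    rw [← sum_add_distrib, ← sum_add_distrib]
    refine sum_le_sum fun r hr => ?_
    obtain ⟨h1, h2, -⟩ := (Sunflower.mem_partsOf_iff).1 hr
    have h3 : W \ (r.1 ∪ r.2) ⊆ W := sdiff_subset
    exact pcFlipIneqK _ _ _ _ _ _ (hpc _ h1) (hpc _ h2) (hpc _ h3)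
  linarith

/-- **The flip inequality at a petal-completing module**: `0 ≤ gsum W M M ∅`. [this work] -/
theorem gsum_twoLift_nonneg_of_completing (W M : Finset α) (hpc : ∀ X ⊆ W, F.lab X = 0 ∨ F.lab (X ∪ M) = Fin.last (k + 1)) :
    0 ≤ F.gsum W M M ∅ := by
  have h := F.gsum_twoLift_sum_nonneg_of_completing W M hpc
  rw [F.gsum_swap23 W M ∅ M, F.gsum_swap12 W ∅ M M, F.gsum_swap23 W M ∅ M] at h
  linarith

/-- **One-lift sums at a petal-completing module are nonnegative** (glued form of `pcIneqK`): `0 ≤ gsum W M ∅ ∅`. [this work] -/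
theorem gsum_oneLift_nonneg_of_completing (W M : Finset α) (hpc : ∀ X ⊆ W, F.lab X = 0 ∨ F.lab (X ∪ M) = Fin.last (k + 1)) :
    0 ≤ F.gsum W M ∅ ∅ := by
  have g1 := F.sum_partsOf_kkK_nonneg' W
  have g2 : 0 ≤ ∑ r ∈ partsOf W, kkK k (F.lab r.1) (F.lab (W \ (r.1 ∪ r.2))) := by
    have h : ∑ r ∈ partsOf W, kkK k (F.lab r.1) (F.lab (W \ (r.1 ∪ r.2))) = ∑ r ∈ partsOf W, kkK k (F.lab r.2) (F.lab (W \ (r.1 ∪ r.2))) :=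
      sum_partsOf_swap12 W (fun a _ d => kkK k (F.lab a) (F.lab d))
    rw [h]; exact g1
  have g3 : 0 ≤ ∑ r ∈ partsOf W, kkK k (F.lab r.1) (F.lab r.2) := by
    have h : ∑ r ∈ partsOf W, kkK k (F.lab r.1) (F.lab r.2) = ∑ r ∈ partsOf W, kkK k (F.lab r.1) (F.lab (W \ (r.1 ∪ r.2))) :=
      sum_partsOf_swap23 W (fun a b _ => kkK k (F.lab a) (F.lab b))
    rw [h]; exact g2
  have hsum : 0 ≤ F.gsum W M ∅ ∅ + F.gsum W ∅ M ∅ + F.gsum W ∅ ∅ M := by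
    unfold gsum
    simp only [union_empty]
    rw [← sum_add_distrib, ← sum_add_distrib]
    have key : ∑ r ∈ partsOf W, kkK k (F.lab r.2) (F.lab (W \ (r.1 ∪ r.2)))
        + ∑ r ∈ partsOf W, kkK k (F.lab r.1) (F.lab (W \ (r.1 ∪ r.2)))
        + ∑ r ∈ partsOf W, kkK k (F.lab r.1) (F.lab r.2)
        ≤ ∑ r ∈ partsOf W, (s6K k (F.lab (r.1 ∪ M)) (F.lab r.2) (F.lab (W \ (r.1 ∪ r.2)))
            + s6K k (F.lab r.1) (F.lab (r.2 ∪ M)) (F.lab (W \ (r.1 ∪ r.2)))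
            + s6K k (F.lab r.1) (F.lab r.2) (F.lab ((W \ (r.1 ∪ r.2)) ∪ M))) := by
      rw [← sum_add_distrib, ← sum_add_distrib]
      refine sum_le_sum fun r hr => ?_
      obtain ⟨h1, h2, -⟩ := (Sunflower.mem_partsOf_iff).1 hr
      have h3 : W \ (r.1 ∪ r.2) ⊆ W := sdiff_subset
      exact pcIneqK _ _ _ _ _ _ (hpc _ h1) (hpc _ h2) (hpc _ h3)
    linarith
  rw [F.gsum_swap12 W ∅ M ∅, F.gsum_swap23 W ∅ ∅ M, F.gsum_swap12 W ∅ M ∅] at hsum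
  linarith

/-- **COMPLETING-MODULE REDUCTION**: for a module `(M, g)` with `M ⊆ W` such that `M` completes every non-bottom set of the window (`lab X = 0 ∨ lab (X ∪ M) = ⊤`
for `X ⊆ W ∖ M`), ★ₖ on `W` follows from ★ₖ of the deletion (`gsum (W ∖ M) ∅ ∅ ∅ ≥ 0`) and of the contraction (`gsum (W ∖ M) M M M ≥ 0`). [this work] -/
theorem gsum_nonneg_of_isModule_of_completing {M : Finset α} {g : Finset α → Bool} (hF : F.IsModule M g) {W : Finset α} (hMW : M ⊆ W)
    (hpc : ∀ X ⊆ W \ M, F.lab X = 0 ∨ F.lab (X ∪ M) = Fin.last (k + 1))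
    (hdel : 0 ≤ F.gsum (W \ M) ∅ ∅ ∅) (hcon : 0 ≤ F.gsum (W \ M) M M M) : 0 ≤ F.gsum W ∅ ∅ ∅ := by
  have h1 : 0 ≤ F.gsum (W \ M) M ∅ ∅ := F.gsum_oneLift_nonneg_of_completing (W \ M) M hpc
  have h2 : 0 ≤ F.gsum (W \ M) M M ∅ := F.gsum_twoLift_nonneg_of_completing (W \ M) M hpc
  refine F.gsum_nonneg_of_isModule hF hMW (disjoint_empty_left M) (disjoint_empty_left M) (disjoint_empty_left M) fun P => ?_
  rw [empty_union, empty_union, empty_union]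
  unfold glue
  by_cases a0 : (0 : Fin 3) ∈ P <;> by_cases a1 : (1 : Fin 3) ∈ P <;> by_cases a2 : (2 : Fin 3) ∈ P <;>
    simp only [a0, a1, a2, if_true, if_false]
  · exact hcon
  · exact h2
  · rw [← F.gsum_swap23 (W \ M) M M ∅]; exact h2
  · exact h1
  · rw [F.gsum_swap12 (W \ M) ∅ M M, ← F.gsum_swap23 (W \ M) M M ∅]; exact h2
  · rw [F.gsum_swap12 (W \ M) ∅ M ∅]; exact h1
  · rw [F.gsum_swap23 (W \ M) ∅ ∅ M, F.gsum_swap12 (W \ M) ∅ M ∅]; exact h1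
  · exact hdel

/-- **CONJECTURE G FOR `D = {e}` AT EVERY PETAL-COMPLETING COORDINATE**: if `lab X = 0 ∨ lab (X ∪ {e}) = ⊤` for all `X ⊆ {e}ᶜ`, then `0 ≤ ZKflip {e}`.
[this work] -/
theorem ZKflip_singleton_nonneg_of_completing [Fintype α] (e : α)
    (hpc : ∀ X ⊆ ({e}ᶜ : Finset α), F.lab X = 0 ∨ F.lab (X ∪ {e}) = Fin.last (k + 1)) : 0 ≤ F.ZKflip {e} := by
  rw [F.ZKflip_singleton_eq e]
  have h := F.gsum_twoLift_nonneg_of_completing {e}ᶜ {e} hpc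
  have h1 : 0 ≤ F.gsum {e}ᶜ {e} ∅ {e} := by rw [F.gsum_swap23]; exact h
  have h2 : 0 ≤ F.gsum {e}ᶜ ∅ {e} {e} := by rw [F.gsum_swap12, F.gsum_swap23]; exact h
  linarith

/-- The same with the petal-completing hypothesis of `ZK_nonneg_of_petalCompleting` (p-gen 26): `insert e X ∈ A` for every petal set `X ∌ e`. [this work] -/
theorem ZKflip_singleton_nonneg_of_petalCompleting [Fintype α] (e : α)
    (hpc : ∀ X : Finset α, e ∉ X → X ∉ F.A → (∃ i, X ∈ F.V i) → insert e X ∈ F.A) : 0 ≤ F.ZKflip {e} := by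
  refine F.ZKflip_singleton_nonneg_of_completing e fun X hX => ?_
  have heX : e ∉ X := fun h => (mem_compl.1 (hX h)) (mem_singleton_self e)
  rw [union_comm, ← insert_eq]
  exact F.lab_zero_or_insert_top hpc heX


end MSunflower

end Summit.CriticalPhenomena.PercolationContinuityZ3.Theorems.SunflowerPartition
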